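import Literature.MathematicalPhysics.QuantumFieldTheory.Balaban1983to89.B8LeafModelZd
import Literature.MathematicalPhysics.QuantumFieldTheory.Balaban1983to89.B8Eq131CubesAdmissible
import Literature.MathematicalPhysics.QuantumFieldTheory.Balaban1983to89.B8Ineq166Univ
import Literature.MathematicalPhysics.QuantumFieldTheory.Balaban1983to89.B8Prop6OfThm4

/-!
# `Balaban1983to89.B8CubeMemberZd` — [Balaban1985RegularSpaces] Sect. F, p. 98–99: THE CUBE FAMILY `{□_j}_{j=0}^{k}` OF (1.131)
# AS A MEMBER OF THE N05 INDEX `B8LeafModelZd.ZdIdx d L`, WITH PRINT'S TRUNCATIONS (p. 88, (1.68) «taking Λ_{k−1} ∪ B(Λ_k) as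
# Λ_{k−1}»), THE FIVE INDEX LAWS PROVED, AND THE DATUM TRANSLATIONS THE p. 99 SENTENCE «the assumptions of Theorem 4 are satisfied
# for the pair of configurations 1, U₀″» NEEDS AT THIS MEMBER

statement-level skeleton of published theorems with citation tags; proofs where landed; nothing here is a claim about the
Yang–Mills mass gap

T. Bałaban, *Spaces of regular gauge field configurations on a lattice and gauge fixing conditions*, Commun. Math. Phys. **99**
(1985) 75–102 `[Balaban1985RegularSpaces]` ("B8").  PDF held: `paper:balaban1985-cmp99-regular-spaces-gauge-fixing` (journal page =
PDF page + 74); loci: p. 77 (1.3)–(1.6), p. 79 (1.19)–(1.20), p. 81 (1.29), p. 87 (1.66), p. 88 (1.68), p. 98 (construction of `□_j`,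
`□̃`), p. 99 (1.131)–(1.133) and the sentence quoted above.

CITATION HEADER (lean-in-tree rule).  Cell `pub-ymgap` (YM Track A, HUMAN RULING D-0062), DAG node N05 = [B8], seat `pub-ymgap-dag-n05-c`
(R134 fan-out; FAN-OUT v1.1 §N05 row s3b «Proposition 6 at a CONCRETE cube family», kernel half; desk note
`HOME/pub-ymgap-dag-n05-a/S3B-PROP6-DESIGN-g6.md` §«module 1»).  WHY: the N05 knit `B8LeafKnitZd3B9All.b8LeafRS_zd3_univ_b9all` carries
Proposition 6 (p. 99) as a printed MEMBER hypothesis `p6 : B8.Prop6Printed …`; print proves Proposition 6 by applying Theorem 4 to the pair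
`1, U₀″` on the cube family `{□_j}`; the tree has Theorem 4 on the concrete `ℤᵈ` carriers for every member of `ZdIdx d L`
(`B8Thm4Concrete.thm4Body_concrete_uniform`, `B8LeafModelZd3.thm4Printed_zd3_of_HFP₄`, modulo the Prop.-5 ∕ b9 sockets) and the cube
geometry (`B8Eq131Cubes`, `B8Eq131CubesAdmissible`), but NO member of `ZdIdx d L` whose domains are the cubes.  THIS FILE supplies that
member and the hypothesis translations; the application of the driver (Proposition 6 at the member) and the `B8.CubeData` packaging are
separate modules.

WHAT IS PRINTED (verbatim, text layer).  p. 77: *"Λ_j = Ω_j^{(j)} ∖ Ω_{j+1}^{(j)}, j = 0, …, k − 1, Λ_k = Ω_k^{(k)} (1.5) … Ω_j^{(j)} =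
⋃_{l ≥ j} B^{l−j}(Λ_l) (1.6)"*.  p. 88: *"We assume that there exists a gauge transformation u₁ satisfying (1.29) with k − 1 instead of
k (taking Λ_{k−1} ∪ B(Λ_k) as Λ_{k−1}) … (1.68)"*.  p. 98: *"Let us take a sequence of cubes □₀, □₁, …, □_{k−1}, □_k, □, such that
□_j ⊃ □_{j+1} and a distance between boundaries of these cubes is equal to R₁M₁Lʲη … for every j the cube □_j is a sum of the big blocks
of the lattice T_{L^{−j}}."*  p. 99: *"The sequence of cubes {□_j} is an admissible family of subsets satisfying (1.3), (1.4) … Let us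
define Λ′_j = □_j^{(j)} ∖ □_{j+1}^{(j)}, j = 1, …, k − 1, Λ′_k = □_k^{(k)}, Λ′₀ = T ∖ □₁, ℭ_k = ⋃_{j=0}^{k} Λ′_j, (1.131) … U₀″ ∈
𝔄_k({□_j}, L³α₀) ∩ Ax_k(ℭ_k, 1), (1.132)  |Ū₀″ʲ − 1| < 6dL²Mα₀ on □_j^{(j)}, j = 0, 1, …, k, (1.133) … If 7dL²Mα₀ ≤ c₁, then the
assumptions of Theorem 4 are satisfied for the pair of configurations 1, U₀″"*.

WHAT THIS MODULE PROVES (kernel, 0 sorry; `a`∕`M` = lower corner∕side of `□^{(k)}`, `ρ = R₁M₁`, as in `B8Eq131Cubes`; the family of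
(1.132) is `B8Eq131CubesAdmissible.cubeFam false L a M ρ k` = `j ↦ □_j` (`j ≤ k`), `Ω₀ = □₀`).
§1 `cubeLam` — (1.5) FOR `{□_j}_{j=0}^{k}`: `Λ_j = □_j^{(j)} ∖ □_{j+1}^{(j)}` (`j < k`), `Λ_k = □_k^{(k)}`, as level-`j` site sets; it
   IS print's `Λ′_j` of (1.131) (`B8Eq131Cubes.LamP`) for `1 ≤ j` (`cubeLam_eq_LamP`) and `□₀ ∖ □₁ ⊂ Λ′₀ = T ∖ □₁` at `j = 0`
   (`cubeLam_zero_subset_LamP`); `cubeLamS … m` — the level-`m` TRUNCATION of (1.68): `Λ_j` for `j < m`, `□_m^{(m)} = Ω_m^{(m)}` at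
   `j = m`; `cubeLamB … m j` — the constraint-bond class of the truncation (the maximal class the concrete Theorem-4 driver admits: box
   inside `Ω_j`, inner-or-crossing w.r.t. `cubeLamS m`).
§2 THE FIVE INDEX LAWS of `B8LeafModelZd.ZdIdx` for `(Ω, Λs, Λb) := (cubeFam false, cubeLamS, cubeLamB)` (`1 ≤ L ≤ ρ`): nesting (1.3)
   `hΩ_cubeFam`, `hbox_cubeLamB`, `hclass_cubeLamB` (by construction), `htower_cubeLam` («Bʲ(Λ_j) ⊂ Ω_j», from `mem_cube_iff`),
   `hpart_cubeLam` ((1.6) at level 0: `Ω₀ = ⋃_j Bʲ(Λ_j)`, by `B8Ineq132.exists_layer` and the floor map `flm`); packaged as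
   **`exists_member_cube`**: `∃ i : ZdIdx d L` with `i.k = k`, `i.η = η`, `i.Ω = cubeFam false …`, `i.Λs = cubeLamS …`, `i.Λb = cubeLamB …`
   (the pattern of `B8LeafModelZd3NonVacuity.exists_member_univ`: every field pinned by an equation).
§3 THE DATUM TRANSLATIONS for the p. 99 sentence at this member: `cubeLamS_cover` ((1.6) at every truncation level: each site of
   `cubeLamS m j` lies under some `Λ_{j′}`, `j ≤ j′ ≤ k`); `inAx_of_cover` (generic: such a cover transports (1.19)∕(1.34)
   `InAx L k (Λs k)` down to `InAx L m (Λs m)`); **`inAx_cubeLamS_of_inAxOne`** ((1.132)'s `Ax_k(ℭ_k, 1)` = `B8Ineq132.InAxOne L k (LamP …)`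
   gives the driver's `∀ m ≤ k, InAx L m (cubeLamS … m) 1 W`); **`h135_of_cond166_one`** ((1.133) in the shape `B8Prop6OfThm4.Cond166 … 1 W α`
   gives the driver's box-form (1.66) clause `‖W̄ʲ_b − 1̄ʲ_b‖ ≤ α` at every level-`j` bond whose box lies in `□_j`, `avgIter_one`);
   `restr_cubeLamS_iff` ((1.29) w.r.t. `cubeLamS k` together with «`u = 1` off `□₀`» ⟺ (1.29) w.r.t. print's `ℭ_k = LamP` with the same
   support clause — the driver's gauge group is carried by `Ω₀ = □₀`, print's `u` is «defined on □̃»).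

HONEST SCOPE.  (i) Geometry and bookkeeping of print's own family only; nothing of Bałaban's analysis is asserted or used.  (ii) The
level-0 restriction set is `□₀ ∖ □₁`, not print's `Λ′₀ = T ∖ □₁`: with the gauge group carried by `□₀` the two readings of (1.29) coincide
(`restr_cubeLamS_iff`); (1.19) does not read level 0.  (iii) `Ω₀ = □₀` (`top := false`) is forced by (1.132)'s currency `𝔄_k({□_j}, ·)`;
consequently the driver's level-0 (1.66)-clause on the plaquette-collar of `□₀` is NOT implied by (1.133)∕`Cond166` (desk-note mismatch 2) — it
is supplied for `U₀″` from (1.130) in the sequel module, not here.  (iv) `ℤᵈ` carriers (`T_η ↦ ℤᵈ`, as in the whole N05 lineage).  Count-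
neutral; N05 NOT discharged; nothing continuum ∕ ℝ⁴ ∕ OS ∕ mass-gap ∕ Clay.  Unit `pub-ymgap-dag-n05-c` (g0), 2026-08-26.
VERSION v1.1 (same seat, APPEND-ONLY; referee ref-A g12 READ-1 remark (R2)): `restr_cubeLamS_supp_iff_restr_LamP` — the support clause on
print's side of `restr_cubeLamS_iff` is redundant ((1.29) on `Λ′₀ = T ∖ □₁` forces `u = 1` off `□₀`).  Everything else unchanged.
-/

noncomputable section

namespace Literature.MathematicalPhysics.QuantumFieldTheory.Balaban1983to89.B8CubeMemberZd

open B7Prop1Explicit B7Prop2Explicit B7Prop1Local B8Ineq130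
open B8Ineq132 (InAk InAxOne Under layer exists_layer avgIter_one)
open B8Thm2LogB (blockTop)
open B8Eq119TwistedAxial (InAx Restr129 inAx_one_iff restr129_level_zero)
open B8Lemma1NonAbelian (mulCfg)
open B8Eq131Cubes (cube sqLo sqHi inLo inHi LamP flm under_flm mem_cube_iff)
open B8Eq131CubesAdmissible (cubeFam cubeFam_false_of_le cubeFam_false_zero cubeFam_of_lt cubeFam_domainSeq smul_mem_cube_iff
  smul_mem_cube_succ_iff inBox_tower_smul_iff)
open B8Eq106Local (under_iff_tower)
open B8Ineq166Univ (under_add_of_under)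
open B8Eq131Derivation (under_zero_iff)
open B8LeafModelZd (ZdIdx)
open B8Prop6OfThm4 (Cond166 tavg_one)

export B7Prop1Explicit (Site)

variable {d : ℕ}

/-! ## §0 Small bookkeeping: boxes, blocks, scaling -/

/-- `InBox lo hi x` is the pair of componentwise inequalities `lo ≤ x ≤ hi`. [folklore] -/
private theorem inBox_iff_le (lo hi x : Site d) : InBox lo hi x ↔ lo ≤ x ∧ x ≤ hi :=
  ⟨fun h => ⟨fun i => (h i).1, fun i => (h i).2⟩, fun h i => ⟨h.1 i, h.2 i⟩⟩

/-- `x ∈ Bᵐ(y)` («x₀ ∈ Bʲ(x_j)», the `m`-fold block) in the two spellings of the lineage: the tower box `[tlo L y m, thi L y m]` of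
`B8Ineq130` and `B8Ineq132.Under`. [cite: Balaban1985RegularSpaces, (1.6) p.77, p.79 («x₀ ∈ Bʲ(x_j)»)] -/
theorem inBox_tower_iff_under (L m : ℕ) (y x : Site d) : InBox (tlo L y m) (thi L y m) x ↔ Under L m y x := by
  rw [inBox_iff_le, under_iff_tower]

/-- Scaling in the block tower: `Lᵐ•x ∈ B^{n+m}(y) ⇔ x ∈ Bⁿ(y)` (the blocks `B^{l−j}(Λ_l)` of (1.6) read on a finer lattice).
[cite: Balaban1985RegularSpaces, (1.6) p.77] -/
theorem under_smul_iff {L : ℕ} (hL : 1 ≤ L) (n m : ℕ) (y x : Site d) :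
    Under L (n + m) y (((L : ℤ) ^ m) • x) ↔ Under L n y x := by
  rw [← inBox_tower_iff_under, ← inBox_tower_iff_under]
  exact inBox_tower_smul_iff hL y y n m x

/-- The floor map inverts `Under`: `x ∈ Bᵐ(z) ⇒ ⌊x∕Lᵐ⌋ = z` (private plumbing). [folklore] -/
private theorem flm_eq_of_under' {L : ℕ} (hL : 1 ≤ L) {m : ℕ} {z x : Site d} (hx : Under L m z x) : flm L m x = z := by
  funext i
  obtain ⟨h1, h2⟩ := hx i
  have hL0 : (0 : ℤ) < (L : ℤ) := by exact_mod_cast hL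
  have hpos : (0 : ℤ) < (L : ℤ) ^ m := pow_pos hL0 m
  simp only [flm]
  have hlo : z i ≤ x i / (L : ℤ) ^ m := Int.le_ediv_of_mul_le hpos (by linarith)
  have hhi : x i / (L : ℤ) ^ m < z i + 1 := Int.ediv_lt_of_lt_mul hpos (by linarith)
  omega

/-- The corner `Lʲ•z` of a level-`j` bond `⟨z, z + e_μ⟩` lies in its box `Bʲ(z) ∪ Bʲ(z + e_μ)` (`B7Prop1Local.loK`∕`bondHiK`, the locality
box of the `j`-fold average (43) of [3]). [cite: Balaban1985Averaging, p.24 (sentence after (43))] -/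
theorem smul_mem_bondBox {L : ℕ} (hL : 1 ≤ L) (j : ℕ) (z : Site d) (μ : Fin d) :
    InBox (loK L j z) (bondHiK L j z μ) (((L : ℤ) ^ j) • z) := by
  intro i
  have hLj : (1 : ℤ) ≤ (L : ℤ) ^ j := one_le_pow₀ (by exact_mod_cast hL)
  simp only [loK, bondHiK, Pi.smul_apply, smul_eq_mul]
  split_ifs <;> constructor <;> linarith

/-- The corner `Lʲ•(z + e_μ)` of a level-`j` bond `⟨z, z + e_μ⟩` lies in its box `Bʲ(z) ∪ Bʲ(z + e_μ)` (`B7Prop1Local.loK`∕`bondHiK`).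
[cite: Balaban1985Averaging, p.24 (sentence after (43))] -/
theorem smul_add_mem_bondBox {L : ℕ} (hL : 1 ≤ L) (j : ℕ) (z : Site d) (μ : Fin d) :
    InBox (loK L j z) (bondHiK L j z μ) (((L : ℤ) ^ j) • (z + e μ)) := by
  intro i
  have hLj : (1 : ℤ) ≤ (L : ℤ) ^ j := one_le_pow₀ (by exact_mod_cast hL)
  simp only [loK, bondHiK, Pi.smul_apply, smul_eq_mul, Pi.add_apply, e, Pi.single_apply]
  split_ifs <;> constructor <;> linarith

/-! ## §1 Print's `Λ_j` of `{□_j}` ((1.5)), the truncations ((1.68)) and the constraint-bond classes -/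

/-- **(1.5) for the cube family `{□_j}_{j=0}^{k}`**: `Λ_j = □_j^{(j)} ∖ □_{j+1}^{(j)}` for `j < k`, `Λ_k = □_k^{(k)}`, as sets of level-`j`
sites (`□_j^{(j)} = [sqLo j, sqHi j]`, `□_{j+1}^{(j)} = [inLo j, inHi j]` of `B8Eq131Cubes`).  For `1 ≤ j` this is print's `Λ′_j` of
(1.131); at `j = 0` it is `□₀ ∖ □₁` (print's `Λ′₀ = T ∖ □₁` relative to `Ω₀ = □₀`).
[cite: Balaban1985RegularSpaces, (1.5) p.77, (1.131) p.99] -/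
def cubeLam (L : ℕ) (a : Site d) (M ρ k j : ℕ) : Set (Site d) :=
  {z | InBox (sqLo L a ρ k j) (sqHi L a M ρ k j) z ∧ (j < k → ¬ InBox (inLo L a ρ k j) (inHi L a M ρ k j) z)}

/-- `cubeLam` IS print's `Λ′_j` of (1.131) (`B8Eq131Cubes.LamP`) for `1 ≤ j`. [cite: Balaban1985RegularSpaces, (1.131) p.99] -/
theorem cubeLam_eq_LamP (L : ℕ) (a : Site d) (M ρ k : ℕ) {j : ℕ} (hj : 1 ≤ j) :
    cubeLam L a M ρ k j = LamP L a M ρ k j := by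
  have hj0 : j ≠ 0 := by omega
  ext z
  simp only [cubeLam, LamP, if_neg hj0, Set.mem_setOf_eq]

/-- At `j = 0`: `cubeLam … 0 = □₀ ∖ □₁` (fine-lattice sets; `k ≥ 1`). [cite: Balaban1985RegularSpaces, (1.5) p.77, p.98] -/
theorem mem_cubeLam_zero_iff {L : ℕ} (hL : 1 ≤ L) (a : Site d) (M ρ : ℕ) {k : ℕ} (hk : 1 ≤ k) (x : Site d) :
    x ∈ cubeLam L a M ρ k 0 ↔ x ∈ cube L a M ρ k 0 ∧ x ∉ cube L a M ρ k 1 := by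
  have h0 : ((L : ℤ) ^ 0) • x = x := by rw [pow_zero, one_smul]
  have h1 := smul_mem_cube_iff hL a M ρ k 0 x
  have h2 := smul_mem_cube_succ_iff hL a M ρ (k := k) (j := 0) (by omega) x
  rw [h0] at h1 h2
  simp only [cubeLam, Set.mem_setOf_eq, Nat.zero_add] at h2 ⊢
  rw [h1, h2]
  exact ⟨fun h => ⟨h.1, h.2 (by omega)⟩, fun h => ⟨h.1, fun _ => h.2⟩⟩

/-- `□₀ ∖ □₁ ⊂ Λ′₀ = T ∖ □₁` (print's level-0 piece of `ℭ_k`). [cite: Balaban1985RegularSpaces, (1.131) p.99] -/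
theorem cubeLam_zero_subset_LamP {L : ℕ} (hL : 1 ≤ L) (a : Site d) (M ρ : ℕ) {k : ℕ} (hk : 1 ≤ k) :
    cubeLam L a M ρ k 0 ⊆ LamP L a M ρ k 0 := by
  intro x hx
  rw [mem_cubeLam_zero_iff hL a M ρ hk] at hx
  simp only [LamP]
  exact hx.2

/-- **The level-`m` TRUNCATION of the restriction sets** (p. 88, (1.68) «taking Λ_{k−1} ∪ B(Λ_k) as Λ_{k−1}», iterated): `Λ_j` for
`j < m`, `Ω_m^{(m)} = □_m^{(m)}` at `j = m` (= `Λ_m ∪ B(Λ_{m+1}) ∪ B²(Λ_{m+2}) ∪ …` by (1.6)), `∅` above `m`.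
[cite: Balaban1985RegularSpaces, (1.68) p.88, (1.6) p.77] -/
def cubeLamS (L : ℕ) (a : Site d) (M ρ k m j : ℕ) : Set (Site d) :=
  if j < m then cubeLam L a M ρ k j
  else if j = m then {z | InBox (sqLo L a ρ k j) (sqHi L a M ρ k j) z} else ∅

/-- Below the truncation level the restriction sets are print's `Λ_j`. [cite: Balaban1985RegularSpaces, (1.68) p.88] -/
theorem cubeLamS_of_lt (L : ℕ) (a : Site d) (M ρ k : ℕ) {m j : ℕ} (hj : j < m) :
    cubeLamS L a M ρ k m j = cubeLam L a M ρ k j := by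
  simp [cubeLamS, hj]

/-- At the truncation level the restriction set is the whole traced cube `□_m^{(m)} = Ω_m^{(m)}`. [cite: Balaban1985RegularSpaces, (1.68) p.88, (1.6) p.77] -/
theorem cubeLamS_self (L : ℕ) (a : Site d) (M ρ k m : ℕ) :
    cubeLamS L a M ρ k m m = {z | InBox (sqLo L a ρ k m) (sqHi L a M ρ k m) z} := by
  simp [cubeLamS]

/-- Above the truncation level `m` there are no restriction sets ((1.68): (1.29) «with k − 1 instead of k»). [cite: Balaban1985RegularSpaces, (1.68) p.88] -/
theorem cubeLamS_of_gt (L : ℕ) (a : Site d) (M ρ k : ℕ) {m j : ℕ} (hj : m < j) :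
    cubeLamS L a M ρ k m j = ∅ := by
  have h1 : ¬ j < m := by omega
  have h2 : j ≠ m := by omega
  simp [cubeLamS, h1, h2]

/-- **No truncation at `m = k`**: `cubeLamS … k j = Λ_j` for every `j ≤ k`. [cite: Balaban1985RegularSpaces, (1.5) p.77, (1.131) p.99] -/
theorem cubeLamS_top (L : ℕ) (a : Site d) (M ρ : ℕ) {k j : ℕ} (hj : j ≤ k) :
    cubeLamS L a M ρ k k j = cubeLam L a M ρ k j := by
  rcases Nat.lt_or_ge j k with h | h
  · exact cubeLamS_of_lt L a M ρ k h
  · have hjk : j = k := le_antisymm hj h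
    subst hjk
    rw [cubeLamS_self]
    ext z
    simp only [cubeLam, Set.mem_setOf_eq, lt_self_iff_false, IsEmpty.forall_iff, and_true]

/-- Every restriction site of a truncation lies in the traced cube of its level: `cubeLamS … m j ⊂ □_j^{(j)}` (`Λ_j ⊂ Ω_j^{(j)}`, (1.5)).
[cite: Balaban1985RegularSpaces, (1.5) p.77, (1.131) p.99] -/
theorem inBox_sq_of_mem_cubeLamS {L : ℕ} {a : Site d} {M ρ k m j : ℕ} {z : Site d} (hz : z ∈ cubeLamS L a M ρ k m j) :
    InBox (sqLo L a ρ k j) (sqHi L a M ρ k j) z := by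
  rcases lt_trichotomy j m with h | h | h
  · rw [cubeLamS_of_lt L a M ρ k h] at hz; exact hz.1
  · subst h; rw [cubeLamS_self] at hz; exact hz
  · rw [cubeLamS_of_gt L a M ρ k h] at hz; exact absurd hz (Set.notMem_empty _)

/-- **The constraint-bond class of the truncation at level `m`** — the (1.31)∕(1.37)∕(1.42) bonds of levels `j ≤ m` in the currency of the
concrete Theorem-4 driver (`B8Thm4Concrete.thm4Body_concrete_uniform`, index `B8LeafModelZd.ZdIdx`): a level-`j` bond `c = ⟨c₋, c₊⟩`,
`c₊ = c₋ + e_κ`, whose fine box `Bʲ(c₋) ∪ Bʲ(c₊)` lies in `Ω_j = □_j`, and which is either INNER (`c₋, c₊ ∈ Λ_j`) or CROSSING (one end in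
`Λ_j`, the block under the other end in `Λ_{j−1}`, «All sites of the contours Γ_{b₋,x} belong to Λ_{j−1}» p. 82).  The maximal such class.
[cite: Balaban1985RegularSpaces, (1.31) p.82, (1.37) p.82, (1.42) p.83, (1.131) p.99] -/
def cubeLamB (L : ℕ) (a : Site d) (M ρ k m j : ℕ) : Set (Site d × Fin d) :=
  {c | (∀ x, InBox (loK L j c.1) (bondHiK L j c.1 c.2) x → x ∈ cubeFam false L a M ρ k j) ∧
    ((c.1 ∈ cubeLamS L a M ρ k m j ∧ c.1 + e c.2 ∈ cubeLamS L a M ρ k m j) ∨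
      (∃ j', j = j' + 1 ∧ (∀ x, (L : ℤ) • c.1 ≤ x → x ≤ (L : ℤ) • c.1 + blockTop L → x ∈ cubeLamS L a M ρ k m j') ∧
        c.1 + e c.2 ∈ cubeLamS L a M ρ k m j) ∨
      (∃ j', j = j' + 1 ∧ c.1 ∈ cubeLamS L a M ρ k m j ∧
        (∀ x, (L : ℤ) • (c.1 + e c.2) ≤ x → x ≤ (L : ℤ) • (c.1 + e c.2) + blockTop L → x ∈ cubeLamS L a M ρ k m j')))}

/-! ## §2 The five index laws and the member -/

/-- **(1.3) for `{□_j}`**: `Ω_{j+1} ⊂ Ω_j` (`B8Eq131CubesAdmissible.cubeFam_domainSeq`, `1 ≤ L ≤ R₁M₁`).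
[cite: Balaban1985RegularSpaces, (1.3) p.77, p.99 («admissible family of subsets satisfying (1.3), (1.4)»)] -/
theorem hΩ_cubeFam {L : ℕ} (hL : 1 ≤ L) (a : Site d) (M : ℕ) {ρ : ℕ} (hρ : L ≤ ρ) (k : ℕ) :
    ∀ j, cubeFam false L a M ρ k (j + 1) ⊆ cubeFam false L a M ρ k j :=
  fun j => (cubeFam_domainSeq false hL a M hρ k).anti j

/-- Law `hbox` of `ZdIdx` for the class `cubeLamB` (by construction). [cite: Balaban1985RegularSpaces, (1.31) p.82] -/
theorem hbox_cubeLamB (L : ℕ) (a : Site d) (M ρ k : ℕ) :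
    ∀ m, m ≤ k → ∀ j, j ≤ m → ∀ c ∈ cubeLamB L a M ρ k m j, ∀ x,
      InBox (loK L j c.1) (bondHiK L j c.1 c.2) x → x ∈ cubeFam false L a M ρ k j :=
  fun _ _ _ _ _ hc x hx => hc.1 x hx

/-- Law `hclass` of `ZdIdx` for the class `cubeLamB` (by construction). [cite: Balaban1985RegularSpaces, (1.31) p.82, p.82 («All sites of the contours Γ_{b₋,x} belong to Λ_{j−1}»)] -/
theorem hclass_cubeLamB (L : ℕ) (a : Site d) (M ρ k : ℕ) :
    ∀ m, m ≤ k → ∀ j, j ≤ m → ∀ c ∈ cubeLamB L a M ρ k m j,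
      (c.1 ∈ cubeLamS L a M ρ k m j ∧ c.1 + e c.2 ∈ cubeLamS L a M ρ k m j) ∨
      (∃ j', j = j' + 1 ∧ (∀ x, (L : ℤ) • c.1 ≤ x → x ≤ (L : ℤ) • c.1 + blockTop L → x ∈ cubeLamS L a M ρ k m j') ∧
        c.1 + e c.2 ∈ cubeLamS L a M ρ k m j) ∨
      (∃ j', j = j' + 1 ∧ c.1 ∈ cubeLamS L a M ρ k m j ∧
        (∀ x, (L : ℤ) • (c.1 + e c.2) ≤ x → x ≤ (L : ℤ) • (c.1 + e c.2) + blockTop L → x ∈ cubeLamS L a M ρ k m j')) :=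
  fun _ _ _ _ _ hc => hc.2

/-- «Ω_j is a sum of cubes of the size Lʲη» for `□_j`: the level-`j` block of any site of `□_j` lies in `□_j`. [cite: Balaban1985RegularSpaces, (1.4) p.77, p.98 («for every j the cube □_j is a sum of the big blocks»)] -/
theorem cube_blockSat {L : ℕ} (hL : 1 ≤ L) (a : Site d) (M ρ k j : ℕ) {x x' : Site d} (hx : x ∈ cube L a M ρ k j)
    (hx' : Under L j (flm L j x) x') : x' ∈ cube L a M ρ k j := by
  obtain ⟨z, hz, hU⟩ := (mem_cube_iff hL).1 hx
  rw [flm_eq_of_under' hL hU] at hx'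
  exact (mem_cube_iff hL).2 ⟨z, hz, hx'⟩

/-- **Law `htower`** («Bʲ(Λ_j) ⊂ Ω_j», p. 77): the level-`j` tower over a site of `Λ_j` (indeed over any site of `□_j^{(j)}`) lies in
`□_j`. [cite: Balaban1985RegularSpaces, (1.5)–(1.6) p.77, p.98] -/
theorem htower_cubeLam {L : ℕ} (hL : 1 ≤ L) (a : Site d) (M ρ k : ℕ) :
    ∀ j, j ≤ k → ∀ y ∈ cubeLamS L a M ρ k k j, ∀ x, InBox (tlo L y j) (thi L y j) x → x ∈ cubeFam false L a M ρ k j := by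
  intro j hj y hy x hx
  rw [cubeFam_false_of_le L a M ρ hj]
  exact (mem_cube_iff hL).2 ⟨y, inBox_sq_of_mem_cubeLamS hy, (inBox_tower_iff_under L j y x).1 hx⟩

/-- If `Lʲ•y ∈ □_{j+1}` then the whole level-`j` block under `y` lies in `□_{j+1}` (`□_{j+1}` is a union of level-`(j+1)`, hence of
level-`j`, blocks). [cite: Balaban1985RegularSpaces, p.98 («□_j is a sum of the big blocks of the lattice T_{L^{−j}}»)] -/
theorem block_subset_cube_succ {L : ℕ} (hL : 1 ≤ L) (a : Site d) (M ρ k j : ℕ) {y x : Site d}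
    (hy : ((L : ℤ) ^ j) • y ∈ cube L a M ρ k (j + 1)) (hx : Under L j y x) : x ∈ cube L a M ρ k (j + 1) := by
  obtain ⟨z, hz, hU⟩ := (mem_cube_iff hL).1 hy
  have h1 : Under L 1 z y := (under_smul_iff hL 1 j z y).1 (by rw [Nat.add_comm]; exact hU)
  have h2 : Under L (1 + j) z x := under_add_of_under h1 hx
  rw [Nat.add_comm] at h2
  exact (mem_cube_iff hL).2 ⟨z, hz, h2⟩

/-- **From the layers of `{□_j}` to `Λ_j`**: a fine site `v ∈ □_l` not in `□_{l+1}` (for `l < k`) has its level-`l` label `⌊v∕Lˡ⌋` in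
`Λ_l` and lies under it. [cite: Balaban1985RegularSpaces, (1.5)–(1.6) p.77] -/
theorem flm_mem_cubeLam_of_layer {L : ℕ} (hL : 1 ≤ L) (a : Site d) (M ρ : ℕ) {k l : ℕ} (hl : l ≤ k) {v : Site d}
    (hv : v ∈ layer (cubeFam false L a M ρ k) k l) : flm L l v ∈ cubeLam L a M ρ k l ∧ Under L l (flm L l v) v := by
  obtain ⟨hv1, hv2⟩ := hv
  rw [cubeFam_false_of_le L a M ρ hl] at hv1
  obtain ⟨z, hz, hU⟩ := (mem_cube_iff hL).1 hv1
  have hflm : flm L l v = z := flm_eq_of_under' hL hU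
  rw [hflm]
  refine ⟨⟨hz, fun hlk hin => ?_⟩, hU⟩
  have hv2' := hv2 hlk
  rw [cubeFam_false_of_le L a M ρ (Nat.succ_le_of_lt hlk)] at hv2'
  exact hv2' (block_subset_cube_succ hL a M ρ k l ((smul_mem_cube_succ_iff hL a M ρ hlk z).2 hin) hU)

/-- **Law `hpart`** ((1.6) at level 0 for `{□_j}`: `□₀ = ⋃_{j=0}^{k} Bʲ(Λ_j)`): every fine site of `Ω₀ = □₀` lies under some `y ∈ Λ_j`,
`j ≤ k` (the largest `j` with `x ∈ □_j`, `B8Ineq132.exists_layer`). [cite: Balaban1985RegularSpaces, (1.6) p.77] -/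
theorem hpart_cubeLam {L : ℕ} (hL : 1 ≤ L) (a : Site d) (M ρ k : ℕ) :
    ∀ x, x ∈ cubeFam false L a M ρ k 0 → ∃ j, j ≤ k ∧ ∃ y ∈ cubeLamS L a M ρ k k j, InBox (tlo L y j) (thi L y j) x := by
  intro x hx
  obtain ⟨l, -, hlk, hv⟩ := exists_layer (Ω := cubeFam false L a M ρ k) (Nat.zero_le k) hx
  obtain ⟨hmem, hU⟩ := flm_mem_cubeLam_of_layer hL a M ρ hlk hv
  refine ⟨l, hlk, flm L l x, ?_, (inBox_tower_iff_under L l _ x).2 hU⟩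
  rw [cubeLamS_top L a M ρ hlk]
  exact hmem

/-- **THE CUBE FAMILY `{□_j}_{j=0}^{k}` OF (1.131) IS A MEMBER OF THE N05 INDEX `B8LeafModelZd.ZdIdx d L`** with print's truncations:
for `1 ≤ L ≤ R₁M₁`, `k ≥ 1`, `η > 0` there is `i : ZdIdx d L` with `i.k = k`, `i.η = η`, `i.Ω = cubeFam false L a M ρ k` (`Ω_j = □_j`),
`i.Λs = cubeLamS L a M ρ k` (`Λs m` = the level-`m` truncation of `(Λ_j)`), `i.Λb = cubeLamB L a M ρ k` — all five index laws checked.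
(Pattern of `B8LeafModelZd3NonVacuity.exists_member_univ`: theorems only, every field pinned by an equation.)
[cite: Balaban1985RegularSpaces, (1.131) p.99, p.99 («The sequence of cubes {□_j} is an admissible family»), (1.3)–(1.6) p.77, (1.68) p.88] -/
theorem exists_member_cube {L : ℕ} (hL : 1 ≤ L) (a : Site d) (M : ℕ) {ρ : ℕ} (hρ : L ≤ ρ) {k : ℕ} (hk : 1 ≤ k) {η : ℝ} (hη : 0 < η) :
    ∃ i : ZdIdx d L, i.k = k ∧ i.η = η ∧ i.Ω = cubeFam false L a M ρ k ∧ i.Λs = cubeLamS L a M ρ k ∧ i.Λb = cubeLamB L a M ρ k :=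
  ⟨⟨η, hη, k, hk, cubeFam false L a M ρ k, hΩ_cubeFam hL a M hρ k, cubeLamS L a M ρ k, cubeLamB L a M ρ k, hbox_cubeLamB L a M ρ k,
      hclass_cubeLamB L a M ρ k, htower_cubeLam hL a M ρ k, hpart_cubeLam hL a M ρ k⟩, rfl, rfl, rfl, rfl, rfl⟩

/-! ## §3 The datum translations for «the assumptions of Theorem 4 are satisfied for the pair 1, U₀″» at this member -/

/-- **(1.6) at every truncation level**: every restriction site `x_j ∈ cubeLamS … m j` (`j ≤ m ≤ k`) lies under some `y ∈ Λ_{j′}`,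
`j ≤ j′ ≤ k` («Ω_j^{(j)} = ⋃_{l ≥ j} B^{l−j}(Λ_l)»). [cite: Balaban1985RegularSpaces, (1.6) p.77, (1.68) p.88] -/
theorem cubeLamS_cover {L : ℕ} (hL : 1 ≤ L) (a : Site d) (M ρ k : ℕ) :
    ∀ m, m ≤ k → ∀ j, j ≤ m → ∀ xj ∈ cubeLamS L a M ρ k m j,
      ∃ j', j ≤ j' ∧ j' ≤ k ∧ ∃ y ∈ cubeLamS L a M ρ k k j', Under L (j' - j) y xj := by
  intro m hm j hjm xj hxj
  rcases Nat.lt_or_ge j m with hlt | hge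
  · refine ⟨j, le_rfl, by omega, xj, ?_, ?_⟩
    · rw [cubeLamS_top L a M ρ (by omega), ← cubeLamS_of_lt L a M ρ k hlt]; exact hxj
    · rw [Nat.sub_self]; exact (under_zero_iff L xj xj).2 rfl
  · have hjm' : j = m := le_antisymm hjm hge
    subst hjm'
    rw [cubeLamS_self] at hxj
    -- the fine point `Lʲ•xj` lies in `□_j = Ω_j`; take the deepest cube containing it
    have hv : ((L : ℤ) ^ j) • xj ∈ cubeFam false L a M ρ k j := by
      rw [cubeFam_false_of_le L a M ρ hm]; exact (smul_mem_cube_iff hL a M ρ k j xj).2 hxj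
    obtain ⟨l, hjl, hlk, hlay⟩ := exists_layer (Ω := cubeFam false L a M ρ k) hm hv
    obtain ⟨hmem, hU⟩ := flm_mem_cubeLam_of_layer hL a M ρ hlk hlay
    refine ⟨l, hjl, hlk, flm L l (((L : ℤ) ^ j) • xj), ?_, ?_⟩
    · rw [cubeLamS_top L a M ρ hlk]; exact hmem
    · have hU' : Under L ((l - j) + j) (flm L l (((L : ℤ) ^ j) • xj)) (((L : ℤ) ^ j) • xj) := by
        rw [Nat.sub_add_cancel hjl]; exact hU
      exact (under_smul_iff hL (l - j) j _ xj).1 hU'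

section Axial

variable {𝔸 : Type*} [NormedRing 𝔸] [NormedAlgebra ℂ 𝔸] [CompleteSpace 𝔸]

/-- **A cover transports (1.19)∕(1.34) down the truncations** (generic): if every site of `Λ′_j`, `1 ≤ j ≤ m`, lies under some site of
`Λ_{j′}`, `j ≤ j′ ≤ k`, then `Ax_k` w.r.t. `Λ` implies `Ax_m` w.r.t. `Λ′` (the axial conditions (1.19) below a level-`j′` site contain
those below every site under it). [cite: Balaban1985RegularSpaces, (1.19) p.79, (1.6) p.77] -/
theorem inAx_of_cover {L k m : ℕ} {Λ Λ' : ℕ → Set (Site d)}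
    (hcov : ∀ j, 1 ≤ j → j ≤ m → ∀ xj ∈ Λ' j, ∃ j', j ≤ j' ∧ j' ≤ k ∧ ∃ y ∈ Λ j', Under L (j' - j) y xj)
    {U₀ W : Site d → Fin d → 𝔸ˣ} (h : InAx L k Λ U₀ W) : InAx L m Λ' U₀ W := by
  intro j hj1 hjm xj hxj n hn z hz r
  obtain ⟨j', hjj', hj'k, y, hy, hyx⟩ := hcov j hj1 hjm xj hxj
  have hz' : Under L (j' - (n + 1)) y z := by
    have := under_add_of_under hyx hz
    have he : j' - j + (j - (n + 1)) = j' - (n + 1) := by omega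
    rwa [he] at this
  exact h j' (by omega) hj'k y hy n (by omega) z hz' r

/-- **(1.132)'s `Ax_k(ℭ_k, 1)` FEEDS THE DRIVER AT EVERY TRUNCATION LEVEL**: `B8Ineq132.InAxOne L k (LamP …) W` (the form certified for
`U₀″` by `B8Eq131Cubes.ineq132_cubes`) gives `InAx L m (cubeLamS … m) 1 W` for every `m ≤ k` (`inAx_one_iff`; `Λ_j = Λ′_j` for `j ≥ 1`;
(1.6) `cubeLamS_cover`). [cite: Balaban1985RegularSpaces, (1.132) p.99, (1.19)–(1.20) p.79, (1.6) p.77] -/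
theorem inAx_cubeLamS_of_inAxOne {L : ℕ} (hL : 1 ≤ L) (a : Site d) (M ρ k : ℕ) {W : Site d → Fin d → 𝔸ˣ}
    (h : InAxOne L k (LamP L a M ρ k) W) :
    ∀ m, m ≤ k → InAx L m (cubeLamS L a M ρ k m) (1 : Site d → Fin d → 𝔸ˣ) W := by
  have hk : InAx L k (cubeLamS L a M ρ k k) (1 : Site d → Fin d → 𝔸ˣ) W := by
    rw [inAx_one_iff]
    intro j hj1 hjk xj hxj
    rw [cubeLamS_top L a M ρ hjk, cubeLam_eq_LamP L a M ρ k hj1] at hxj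
    exact h j hj1 hjk xj hxj
  intro m hm
  exact inAx_of_cover (fun j _ hjm xj hxj => cubeLamS_cover hL a M ρ k m hm j hjm xj hxj) hk

end Axial

/-- **A level-`j` bond whose fine box lies in `□_j` has both ends in `□_j^{(j)}`** (the corners `Lʲ•z`, `Lʲ•(z + e_μ)` of the box lie
in `□_j`; `smul_mem_cube_iff`). [cite: Balaban1985RegularSpaces, p.98 («□_j is a sum of the big blocks»), (1.66) p.87] -/
theorem ends_inBox_sq_of_bondBox_subset {L : ℕ} (hL : 1 ≤ L) (a : Site d) (M ρ k j : ℕ) {z : Site d} {μ : Fin d}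
    (hbox : ∀ x, InBox (loK L j z) (bondHiK L j z μ) x → x ∈ cube L a M ρ k j) :
    sqLo L a ρ k j ≤ z ∧ z + e μ ≤ sqHi L a M ρ k j := by
  have h1 := (smul_mem_cube_iff hL a M ρ k j z).1 (hbox _ (smul_mem_bondBox hL j z μ))
  have h2 := (smul_mem_cube_iff hL a M ρ k j (z + e μ)).1 (hbox _ (smul_add_mem_bondBox hL j z μ))
  exact ⟨fun i => (h1 i).1, fun i => (h2 i).2⟩

section Averages

variable {𝔸 : Type*} [NormedRing 𝔸] [NormedAlgebra ℂ 𝔸] [CompleteSpace 𝔸]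

/-- **(1.133)∕(1.66) IN THE SHAPE `Cond166 … 1 W α` GIVES THE DRIVER'S BOX-FORM CLAUSE AT `U₀ = 1`**: for every `j ≤ k` and every
level-`j` bond `⟨z, z + e_μ⟩` whose fine box lies in `Ω_j = □_j`, `‖W̄ʲ(z, μ) − 1̄ʲ(z, μ)‖ ≤ α` (`1̄ʲ = 1`, `B8Ineq132.avgIter_one`; `W·1 = W`).
[cite: Balaban1985RegularSpaces, (1.66) p.87, (1.133) p.99, (1.20) p.79] -/
theorem h135_of_cond166_one {L : ℕ} (hL : 1 ≤ L) (a : Site d) (M ρ k : ℕ) {W : Site d → Fin d → 𝔸ˣ} {α : ℝ}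
    (h : Cond166 L k a M ρ (1 : Site d → Fin d → 𝔸ˣ) W α) :
    ∀ j, j ≤ k → ∀ (z : Site d) (μ : Fin d),
      (∀ x, InBox (loK L j z) (bondHiK L j z μ) x → x ∈ cubeFam false L a M ρ k j) →
        ‖(avgIter L (mulCfg W 1) j z μ : 𝔸) - (avgIter L (1 : Site d → Fin d → 𝔸ˣ) j z μ : 𝔸)‖ ≤ α := by
  intro j hj z μ hbox
  have hW : mulCfg W (1 : Site d → Fin d → 𝔸ˣ) = W := by
    rw [show mulCfg W (1 : Site d → Fin d → 𝔸ˣ) = W * 1 from rfl, mul_one]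
  rw [cubeFam_false_of_le L a M ρ hj] at hbox
  obtain ⟨hlo, hhi⟩ := ends_inBox_sq_of_bondBox_subset hL a M ρ k j hbox
  have h166 := h j hj z μ hlo hhi
  rw [tavg_one] at h166
  rw [hW, avgIter_one, Pi.one_apply, Pi.one_apply, Units.val_one]
  exact h166.le

end Averages

section Restriction

variable {𝔸 : Type*} [NormedRing 𝔸] [NormedAlgebra ℂ 𝔸] [CompleteSpace 𝔸]

/-- **(1.29) AT THE MEMBER ⟺ (1.29) W.R.T. PRINT'S `ℭ_k`** when the gauge group is carried by `Ω₀ = □₀` («`u` defined on □̃», p. 99;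
desk-note mismatch 1): `(R₀u)ʲ = 1` on `cubeLamS … k j = Λ_j` for all `j ≤ k` together with `u = 1` off `□₀` is the same as `(R₀u)ʲ = 1`
on `Λ′_j` (1.131) for all `j ≤ k` with the same support clause — levels `j ≥ 1` agree (`cubeLam_eq_LamP`), and at level 0 both say
`u = 1` on `T ∖ □₁` (`restr129_level_zero`). [cite: Balaban1985RegularSpaces, (1.29) p.81, (1.131) p.99, Prop. 6 p.99] -/
theorem restr_cubeLamS_iff {L : ℕ} (hL : 1 ≤ L) (a : Site d) (M ρ : ℕ) {k : ℕ} (hk : 1 ≤ k) (U₀ : Site d → Fin d → 𝔸ˣ)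
    (u : Site d → 𝔸ˣ) :
    (Restr129 L k (cubeLamS L a M ρ k k) U₀ u ∧ ∀ x, x ∉ cubeFam false L a M ρ k 0 → u x = 1) ↔
      (Restr129 L k (LamP L a M ρ k) U₀ u ∧ ∀ x, x ∉ cubeFam false L a M ρ k 0 → u x = 1) := by
  constructor
  · rintro ⟨hR, hsupp⟩
    refine ⟨fun j hj y hy => ?_, hsupp⟩
    rcases Nat.eq_zero_or_pos j with rfl | hj1
    · -- level 0: `y ∉ □₁`; either `y ∈ □₀` (then `y ∈ Λ₀ = □₀ ∖ □₁`) or `u y = 1` by the support clause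
      rw [B7Eq78Linearization.Rbar_zero]
      by_cases hy0 : y ∈ cubeFam false L a M ρ k 0
      · have hy' : y ∈ cubeLamS L a M ρ k k 0 := by
          rw [cubeLamS_top L a M ρ (Nat.zero_le k), mem_cubeLam_zero_iff hL a M ρ hk]
          rw [cubeFam_false_zero] at hy0
          simp only [LamP] at hy
          exact ⟨hy0, hy⟩
        exact restr129_level_zero hR hy'
      · rw [hsupp y hy0, Units.val_one]
    · rw [← cubeLam_eq_LamP L a M ρ k hj1, ← cubeLamS_top L a M ρ hj] at hy
      exact hR j hj y hy
  · rintro ⟨hR, hsupp⟩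
    refine ⟨fun j hj y hy => ?_, hsupp⟩
    rcases Nat.eq_zero_or_pos j with rfl | hj1
    · rw [cubeLamS_top L a M ρ (Nat.zero_le k)] at hy
      exact hR 0 hj y (cubeLam_zero_subset_LamP hL a M ρ hk hy)
    · rw [cubeLamS_top L a M ρ hj, cubeLam_eq_LamP L a M ρ k hj1] at hy
      exact hR j hj y hy

/-- **v1.1 (referee ref-A g12 READ-1 (R2)): the support clause is REDUNDANT on print's side** — (1.29) w.r.t. print's `ℭ_k = LamP`
alone already forces `u = 1` off `□₀` (its level-0 piece is `Λ′₀ = T ∖ □₁ ⊇ ℤᵈ ∖ □₀`, `restr129_level_zero`), so «(1.29) at the member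
+ `u = 1` off `□₀`» ⟺ «(1.29) w.r.t. `ℭ_k`» with NO support clause on the right: carrying the gauge group by `Ω₀ = □₀` loses nothing.
[cite: Balaban1985RegularSpaces, (1.29) p.81, (1.131) p.99 («Λ′₀ = T ∖ □₁»)] -/
theorem restr_cubeLamS_supp_iff_restr_LamP {L : ℕ} (hL : 1 ≤ L) (a : Site d) (M ρ : ℕ) {k : ℕ} (hk : 1 ≤ k)
    (U₀ : Site d → Fin d → 𝔸ˣ) (u : Site d → 𝔸ˣ) :
    (Restr129 L k (cubeLamS L a M ρ k k) U₀ u ∧ ∀ x, x ∉ cubeFam false L a M ρ k 0 → u x = 1) ↔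
      Restr129 L k (LamP L a M ρ k) U₀ u := by
  constructor
  · intro h
    exact ((restr_cubeLamS_iff hL a M ρ hk U₀ u).1 h).1
  · intro hR
    have hsupp : ∀ x, x ∉ cubeFam false L a M ρ k 0 → u x = 1 := by
      intro x hx
      rw [cubeFam_false_zero] at hx
      have hx1 : x ∉ cube L a M ρ k 1 := fun h1 => hx (B8Eq131Cubes.cube_succ_subset (j := 0) hk h1)
      have hy : x ∈ LamP L a M ρ k 0 := by simp only [LamP]; exact hx1
      exact Units.val_eq_one.1 (restr129_level_zero hR hy)
    exact (restr_cubeLamS_iff hL a M ρ hk U₀ u).2 ⟨hR, hsupp⟩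

end Restriction

#print axioms exists_member_cube
#print axioms inAx_cubeLamS_of_inAxOne
#print axioms h135_of_cond166_one
#print axioms restr_cubeLamS_iff

end Literature.MathematicalPhysics.QuantumFieldTheory.Balaban1983to89.B8CubeMemberZd

end
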